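import Literature.AnabelianGeometry.EtaleTheta.Discharge.Sec5ThetaSubquotientProjGaloisInhabited
import Literature.AnabelianGeometry.EtaleTheta.Discharge.Sec5OfThetaSettingQ
import HarnessLib

/-!
# [EtTh] §5 p.327: the v2 subquotient record `ThetaSubquotientProjGalois` is INHABITED at print's `Q` over `B^temp(Π^tp_X̲̲)⁰` and at
# abc-iut-L2-t4's junction object `ofThetaSettingDataQ` — a `P`-TERM where «no `P` TERM is constructed» (proof-only)

S. Mochizuki, *The étale theta function and its Frobenioid-theoretic manifestations*, Publ. RIMS **45** (2009), §5 p. 327 (PDF p. 101):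
"these subquotients determine subquotients `Aut_D(D) ↠ Aut^Θ_D(D)`; `(l·Δ_Θ)_D ⊆ Aut^Θ_D(D)`" [cite: MochizukiEtTh2009, §5 p.327 (PDF p.101)];
Def. 2.5 (i) / Def. 2.7 pp. 39–41 (the covering `X̲̲ → X`, `Π^tp_X̲̲ ⊆ Π^tp_X`, with `Π^tp_X̲̲ ↠ (Π^tp_X)^Θ ⊇ l·Δ_Θ`).

abc-iut cell, layer L2, seat abc-iut-w6-d079 (gen 6), row «(w4) V1→V2» tranche 1 (abc-iut-L2-lead g7 R915).  PROOF-ONLY (0 definitions); sequel of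
`Sec5ThetaSubquotientProjGaloisInhabited.lean` (p481568).  There inhabitation was proved for `q : Π → Q` ONTO; at print's `Q` over the DOUBLE
UNDERLINE base `B^temp(Π^tp_X̲̲)⁰` (abc-iut-L2-t9's `ofSettingSub D l Π^tp_X̲̲`, the stub of abc-iut-L2-t4's junction object `ofThetaSettingDataQ`,
`Sec5OfThetaSettingQ.lean` p435623) the map `q = (Π^tp_X ↠ (Π^tp_X)^Θ)|_{Π^tp_X̲̲}` is NOT onto — but all the proof needs is
`ι(l·Δ_Θ) ⊆ q(Π^tp_X̲̲)`, which is the field `map_toTheta_Huu : Π^tp_X̲̲.map toTheta ⊓ Δ_Θ = l·Δ_Θ` of abc-iut-L2-t2's `EtaleThetaData.DoubleUnderline`.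
Here:

* `ThetaSubquotient.autProj_surjective_at_galoisObj_of_range_le` / `nonempty_thetaSubquotientProjGalois_of_stub_eq_of_range_le` — the two
  theorems of p481568 with `q` onto weakened to `ι.range ≤ q.range`;
* `nonempty_thetaSubquotientProjGalois_ofSettingSub_of_le` — print's `Q` over `B^temp(U)⁰` for ANY `U ≤ Π^tp_X` with `l·Δ_Θ ≤ U.map toTheta`;
* **`nonempty_thetaSubquotientProjGalois_ofSettingSub_huu`** — `U := Π^tp_X̲̲` (`C.Huu`, any `C : E.DoubleUnderline l`), by `map_toTheta_Huu`;
* **`ThetaFrobenioid.nonempty_thetaSubquotientProjGalois_ofThetaSettingDataQ`** — a `P`-TERM (v2) EXISTS at abc-iut-L2-t4's junction object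
  `ofThetaSettingDataQ μ hC hS h R K' …` (its stub is `ofSettingSub D l C.Huu` by `rfl`, `ofThetaSettingDataQ_toThetaSubquotientStub`) — where
  abc-iut-L2-t9's `Sec5Prop55QPBindersAtSettingQ.lean` (p447951) records for the v1 record «no `P` TERM is constructed» (VNEXT census B1).

HONEST FRAMING: a statement about the cell's OWN typed records at abc-iut-L2-t9's carrier; nothing asserts that [EtTh]'s data exist for an actual
curve (`tf` abstract); [EtTh] is refereed; nothing here bears on [IUTchIII] Cor. 3.12 — no side taken; typed ≠ proved.
-/

noncomputable section

namespace Literature.AnabelianGeometry.EtaleTheta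

open CategoryTheory Literature.AlgebraicGeometry.Frobenioids Literature.AnabelianGeometry.SemiGraphs
open Literature.AlgebraicGeometry.Frobenioids.QuasiTemperoid (stabilizerSubgroup)
open Literature.AlgebraicGeometry.Frobenioids.QuasiTemperoid.BTempConnected (isConnectedObj_iff)
open FrobenioidCyclotomicRigidity (ThetaSubquotientProj ThetaSubquotientProjGalois)
open scoped IsMulCommutative

namespace ThetaSubquotient

universe u v w u₁ v₁

variable {G : Type u} [Group G] [TopologicalSpace G] {Q : Type v} [Group Q] {Λ : Type w} [CommGroup Λ]
  (q : G →* Q) (ι : Λ →* Q) [ι.range.Normal]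

/-! ### 1. `q` onto weakened to `ι(Λ) ⊆ q(Π)` -/

/-- **At a GALOIS object `autProj` is surjective as soon as `ι(Λ) ⊆ q(Π)`** (every class `[a]` needs only ONE `n ∈ Π` with `q(n) = ι(a)`):
the proof of `autProj_surjective_at_galoisObj` verbatim with the weaker hypothesis. [cite: MochizukiEtTh2009, §5 p.327 (PDF p.101)] -/
theorem autProj_surjective_at_galoisObj_of_range_le {E : BTemp G} (hE : IsGaloisObj E) (hq : ι.range ≤ q.range) :
    Function.Surjective (autProj q ι E) := by
  have hEc : IsConnectedObj E := hE.1
  obtain ⟨⟨x⟩, -⟩ := (isConnectedObj_iff E).mp hEc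
  intro c
  obtain ⟨c₀, rfl⟩ := (evalEquiv q ι hEc x).symm.surjective c
  induction c₀ using QuotientGroup.induction_on with
  | H a =>
    obtain ⟨n, hn⟩ := hq (mem_range_self ι a)
    obtain ⟨σ, hσ⟩ := GaloisTorsor.exists_aut_apply_eq_of_isGaloisObj E hE x (E.obj.ρ n x)
    have hmem : σ ∈ autPre q ι E := mem_autPre_of_apply_eq q ι hEc x (hn ▸ mem_range_self ι a) hσ
    refine ⟨⟨σ, hmem⟩, ?_⟩
    apply (evalEquiv q ι hEc x).injective
    rw [MulEquiv.apply_symm_apply, evalEquiv_apply]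
    exact evalAt_autProj q ι E ⟨σ, hmem⟩ x n a hn.symm hσ

section Main

variable {C : Type u₁} [Category.{v₁} C]

/-- **INHABITATION of the v2 record at abc-iut-L2-t9's carrier, for `ι(Λ) ⊆ q(Π)`** (the proof of
`nonempty_thetaSubquotientProjGalois_of_stub_eq` verbatim with the weaker hypothesis). [cite: MochizukiEtTh2009, §5 p.327 (PDF p.101)] -/
theorem nonempty_thetaSubquotientProjGalois_of_stub_eq_of_range_le (hq : ι.range ≤ q.range)
    (𝔉 : ThetaFrobenioid.{max u w} C (ConnectedPart (BTemp G)))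
    (h𝔉 : 𝔉.toThetaSubquotientStub = thetaSubquotientStub q ι) :
    Nonempty (ThetaSubquotientProjGalois 𝔉 fun E => IsGaloisObj E.obj) := by
  cases 𝔉 with
  | mk toTemperedFrobenioidStub toThetaSubquotientStub =>
    dsimp only at h𝔉
    subst h𝔉
    let e : ∀ E : ConnectedPart (BTemp G), Aut E ≃* Aut E.obj := fun E =>
      (connectedObjects (BTemp G)).fullyFaithfulι.autMulEquivOfFullyFaithful E
    let pre : ∀ E : ConnectedPart (BTemp G), Subgroup (Aut E) := fun E => (autPre q ι E.obj).comap (e E).toMonoidHom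
    refine ⟨{ pre := pre
              proj := fun E => (autProj q ι E.obj).comp
                (((e E).toMonoidHom.restrict (pre E)).codRestrict (autPre q ι E.obj) fun σ => σ.2)
              proj_surjective := fun E hE c => ?_ }⟩
    obtain ⟨σ₀, hσ₀⟩ := autProj_surjective_at_galoisObj_of_range_le q ι hE hq c
    have hmem : (e E).symm σ₀.1 ∈ pre E := by
      change (e E) ((e E).symm σ₀.1) ∈ autPre q ι E.obj
      rw [MulEquiv.apply_symm_apply]
      exact σ₀.2
    refine ⟨⟨(e E).symm σ₀.1, hmem⟩, ?_⟩
    rw [← hσ₀]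
    change autProj q ι E.obj ⟨(e E) ((e E).symm σ₀.1), _⟩ = autProj q ι E.obj σ₀
    congr 1

end Main

/-! ### 2. Print's `Q` over `B^temp(U)⁰` with `l·Δ_Θ ≤ U.map toTheta`; the double underline `U = Π^tp_X̲̲` -/

section Setting

variable {p : ℕ} [Fact p.Prime] (D : ThetaSetting p) (l : ℕ) (U : Subgroup D.PiTemp)
  {C : Type u₁} [Category.{v₁} C]

/-- The image of `q = toTheta|_U` is `U.map toTheta`, and the image of `ι` is `l·Δ_Θ`: the range condition of §1 reads `l·Δ_Θ ≤ U.map toTheta`.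
[cite: MochizukiEtTh2009, §5 p.327 (PDF p.101)] -/
theorem range_ιTheta_le_range_qSub_of_le (h : D.lDeltaTheta l ≤ U.map D.toTheta) :
    (ιTheta D l).range ≤ (qSub D U).range := by
  intro x hx
  rw [ThetaSetting.range_subtype_lDeltaTheta] at hx
  obtain ⟨g, hg, rfl⟩ := h hx
  exact ⟨⟨g, hg⟩, rfl⟩

/-- **Print's `Q` over `B^temp(U)⁰`, `U ≤ Π^tp_X` with `l·Δ_Θ ≤ U.map toTheta`**: the v2 record is inhabited for every §5 datum with stub
`ofSettingSub D l U`. [cite: MochizukiEtTh2009, §5 p.327 (PDF p.101)] -/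
theorem nonempty_thetaSubquotientProjGalois_ofSettingSub_of_le (h : D.lDeltaTheta l ≤ U.map D.toTheta)
    (𝔉 : ThetaFrobenioid.{0} C (ConnectedPart (BTemp ↥U)))
    (h𝔉 : 𝔉.toThetaSubquotientStub = ofSettingSub D l U) :
    Nonempty (ThetaSubquotientProjGalois 𝔉 fun E => IsGaloisObj E.obj) :=
  nonempty_thetaSubquotientProjGalois_of_stub_eq_of_range_le (qSub D U) (ιTheta D l)
    (range_ιTheta_le_range_qSub_of_le D l U h) 𝔉 (h𝔉.trans (ofSettingSub_eq D l U))

/-- **The DOUBLE UNDERLINE base `Π^tp_X̲̲`** (abc-iut-L2-t2's `C.Huu` for any `C : E.DoubleUnderline l`): `l·Δ_Θ ≤ Π^tp_X̲̲.map toTheta` is the field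
`map_toTheta_Huu` (`Π^tp_X̲̲.map toTheta ⊓ Δ_Θ = l·Δ_Θ`), so the v2 record is inhabited for every §5 datum with stub `ofSettingSub D l Π^tp_X̲̲`.
[cite: MochizukiEtTh2009, Def 2.7 p.267 (PDF p.41); §5 p.327 (PDF p.101)] -/
theorem nonempty_thetaSubquotientProjGalois_ofSettingSub_huu {E : D.EtaleThetaData} (Cuu : E.DoubleUnderline l)
    (𝔉 : ThetaFrobenioid.{0} C (ConnectedPart (BTemp ↥Cuu.Huu)))
    (h𝔉 : 𝔉.toThetaSubquotientStub = ofSettingSub D l Cuu.Huu) :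
    Nonempty (ThetaSubquotientProjGalois 𝔉 fun E => IsGaloisObj E.obj) :=
  nonempty_thetaSubquotientProjGalois_ofSettingSub_of_le D l Cuu.Huu
    (fun x hx => by
      have h := Cuu.map_toTheta_Huu
      rw [← h] at hx
      exact hx.1) 𝔉 h𝔉

end Setting

end ThetaSubquotient

/-! ### 3. A `P`-term at abc-iut-L2-t4's junction object `ofThetaSettingDataQ` -/

namespace ThetaFrobenioid

open ThetaSubquotient

universe v₀

variable {p : ℕ} [Fact p.Prime] {D : ThetaSetting p} {E : D.EtaleThetaData} {l : ℕ} {C : E.DoubleUnderline l}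
  {e : D.toTemperedCurve.GroupLevelData} {N : ℕ+} (μ : D.CyclotomeMod l N) (hC : D.Compat) (hS : D.Sec2Hyps)
  {D₀ : Type} [Category.{v₀} D₀] {V : FrdIMonoidStub.{0}} {T₀ : RealifiedDivisorMonoids (D₀ := D₀) V}
  {VD : FrdICatStub.{1, 0, 0} (ConnectedPart (BTemp (C.temperedArithmeticGroup e).Pi))}
  {tf : TemperedFrobenioid T₀ (ConnectedPart (BTemp (C.temperedArithmeticGroup e).Pi)) VD} {hZ : tf.monoidType = MonoidType.Z}
  {hP : ∀ A : (ConnectedPart (BTemp (C.temperedArithmeticGroup e).Pi))ᵒᵖ, IsPerfect (tf.Φ.carrier A)}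
  {NH : Subgroup (Field.absoluteGaloisGroup D.K) → tf.category → ℕ+ → Prop} {A₀ : tf.category}
  {hA₀ : PreFrobenioid.IsFrobeniusTrivial tf.toElem A₀} {hA₀' : SemiGraphs.IsGaloisObj A₀.base.obj}
  {pullFrac : ∀ {A A' : (BiKummerSetting.mkOfConnectedTemperoid (C.temperedArithmeticGroup e) tf hZ hP NH A₀ hA₀ hA₀').C} (_ : A' ⟶ A),
    (BiKummerSetting.mkOfConnectedTemperoid (C.temperedArithmeticGroup e) tf hZ hP NH A₀ hA₀ hA₀').biratUnits A →
      (BiKummerSetting.mkOfConnectedTemperoid (C.temperedArithmeticGroup e) tf hZ hP NH A₀ hA₀ hA₀').biratUnits A'}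
  {θ : (BiKummerSetting.mkOfConnectedTemperoid (C.temperedArithmeticGroup e) tf hZ hP NH A₀ hA₀ hA₀').biratUnits
    (BiKummerSetting.mkOfConnectedTemperoid (C.temperedArithmeticGroup e) tf hZ hP NH A₀ hA₀ hA₀').Aodot}
  {Bl : (BiKummerSetting.mkOfConnectedTemperoid (C.temperedArithmeticGroup e) tf hZ hP NH A₀ hA₀ hA₀').C}
  {Pl : (BiKummerSetting.mkOfConnectedTemperoid (C.temperedArithmeticGroup e) tf hZ hP NH A₀ hA₀ hA₀').FractionPair θ Bl}
  {Rl : (BiKummerSetting.mkOfConnectedTemperoid (C.temperedArithmeticGroup e) tf hZ hP NH A₀ hA₀ hA₀').NthRoot θ Pl C.lPNat pullFrac}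
  (h : ModelFrobenioid.Hypotheses tf.divisorMonoid tf.ratFnFunctor)
  (R : (BiKummerSetting.mkOfConnectedTemperoid (C.temperedArithmeticGroup e) tf hZ hP NH A₀ hA₀ hA₀').NthRoot Rl.root Rl.pair N pullFrac)
  (K' : Type) [Field K'] (constEmb : K'ˣ →* tf.biratUnitsModel R.BN) (constEmb_injective : Function.Injective constEmb)
  (hinvc : ∀ g : Aut R.AN.base,
    pull tf.divisorMonoid g.hom (ModelFrobenioid.div R.pair.num) = ModelFrobenioid.div R.pair.num)
  (hinvp : ∀ y : (C.thetaEnvData μ hC hS).PiX, y ∈ (C.thetaEnvData μ hC hS).PiYdd →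
    pull tf.divisorMonoid ((BiKummerSetting.mkOfConnectedTemperoid (C.temperedArithmeticGroup e) tf hZ hP NH A₀ hA₀ hA₀').galoisSurj
      R.AN.base R.αData.isGalois ((ContinuousMulEquiv.refl _) y)).hom (ModelFrobenioid.div R.pair.den) = ModelFrobenioid.div R.pair.den)

/-- **A `P`-TERM (v2) at the junction object**: abc-iut-L2-t4's §5 data of the Setting with print's `Q`, `ofThetaSettingDataQ μ hC hS h R K' …`
(stub `ofSettingSub D l Π^tp_X̲̲` by `rfl`), carries an inhabitant of `ThetaSubquotientProjGalois _ (IsGaloisObj ·.obj)` — where for the v1 record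
abc-iut-L2-t9's p447951 notes «no `P` TERM is constructed» and works modulo the two pin equations instead.
[cite: MochizukiEtTh2009, §5 p.327 (PDF p.101)] -/
theorem nonempty_thetaSubquotientProjGalois_ofThetaSettingDataQ :
    Nonempty (ThetaSubquotientProjGalois
      (ofThetaSettingDataQ μ hC hS h R K' constEmb constEmb_injective hinvc hinvp) fun E => IsGaloisObj E.obj) :=
  nonempty_thetaSubquotientProjGalois_ofSettingSub_huu D l C _
    (ofThetaSettingDataQ_toThetaSubquotientStub μ hC hS h R K' constEmb constEmb_injective hinvc hinvp)

end ThetaFrobenioid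

end Literature.AnabelianGeometry.EtaleTheta

end
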